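import Summits.NavierStokesRegularity.NavierStokesRegularity.Theses.TerminalTrace
import Summits.NavierStokesRegularity.NavierStokesRegularity.Theorems.TerminalTraceTraceDensityCriterionTypeI
import Summits.NavierStokesRegularity.NavierStokesRegularity.Theorems.TraceDensityCriterion.Negative.LoadBearing
import HarnessLib

/-!
# Crux `TerminalTrace.TraceDensityCriterion` (stmt-NavierStokesRegularity-18614): the crux IS its non-Type-I cell, and
# the adversary's normal form refined — any counterexample is a first-time blow-up that is NOT Type-I in time

Seat nsreg-C26-p1 g6 (cell ns-regularity-ideate), `--supports stmt-NavierStokesRegularity-18614` (helper; closes nothing).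
Consequences, by name, of the landed Type-I cell `TerminalTrace.typeI_traceDensityCriterion` (p652624) for the planning /
refutation of the crux, next to the refuter's `TraceDensityCriterion.Negative.not_crux_normal_form` («a counterexample is a
first-time blow-up»):

* `TerminalTrace.traceDensityCriterion_iff_notTypeI_cell` — `TraceDensityCriterion` is EQUIVALENT to its restriction to
  frame solutions that are NOT Type-I in time (`¬ IsTypeIBlowup u T`): the Type-I cell is a theorem, so only the
  Type-II-in-time (or slower-than-no-rate) cell carries content.
* `TerminalTrace.not_traceDensityCriterion_normal_form_notTypeI` — if the crux fails, the witness is a frame solution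
  (`ν, T > 0`, classical on `[0, T)`, Leray–Hopf on `[0, T]`, rapidly decaying datum) with NO smooth extension past `T`,
  which is NOT Type-I in time, together with a vertex `x₀` where the final value has vanishing scaled energy and `u` is
  not backward bounded.

WHAT THIS IS NOT: not NS regularity, not the crux — bookkeeping of where the crux's content sits after the Type-I cell.
[folklore; EscauriazaSereginSverak2003 §3; AlbrittonBarker2019 §3]
-/

set_option linter.dupNamespace false

noncomputable section

open MeasureTheory Set Function Filter Topology Metric
open Literature.Analysis.FluidPDE
open Summit.NavierStokesRegularity.NavierStokesRegularity.Theses.TerminalTrace (TraceDensityCriterion)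

namespace Summit.NavierStokesRegularity.NavierStokesRegularity.Theorems

/-- **The crux `TraceDensityCriterion` is equivalent to its non-Type-I cell**: restricting the frame solutions to those
with `¬ IsTypeIBlowup u T` loses nothing, because the Type-I-in-time cell is the theorem
`TerminalTrace.typeI_traceDensityCriterion`. [folklore] -/
theorem TerminalTrace.traceDensityCriterion_iff_notTypeI_cell : TraceDensityCriterion ↔
    ∀ (ν T : ℝ), 0 < ν → 0 < T →
      ∀ (u : ℝ → EuclideanSpace ℝ (Fin 3) → EuclideanSpace ℝ (Fin 3)) (p : ℝ → EuclideanSpace ℝ (Fin 3) → ℝ),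
      IsClassicalNSSolutionOn (Ico 0 T) ν 0 u p → IsLerayHopfOn T ν 0 (u 0) u →
      HasRapidSpatialDecay (u 0) → ¬ IsTypeIBlowup u T → ∀ x₀ : EuclideanSpace ℝ (Fin 3),
      Tendsto (fun r : ℝ => r⁻¹ * ∫ x in ball x₀ r, ‖u T x‖ ^ 2) (𝓝[>] 0) (𝓝 0) →
      ∃ r > 0, ∃ C : ℝ, ∀ t ∈ Ioo (T - r ^ 2) T, ∀ x ∈ ball x₀ r, ‖u t x‖ ≤ C := by
  refine ⟨fun h ν T hν hT u p hcl hLH hdec _ x₀ hFE => h ν T hν hT u p hcl hLH hdec x₀ hFE,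
    fun h ν T hν hT u p hcl hLH hdec x₀ hFE => ?_⟩
  by_cases hTI : IsTypeIBlowup u T
  · exact TerminalTrace.typeI_traceDensityCriterion ν T hν hT u p hcl hLH hdec hTI x₀ hFE
  · exact h ν T hν hT u p hcl hLH hdec hTI x₀ hFE

/-- **Normal form of a kill, refined by the Type-I cell.** If the crux `TraceDensityCriterion` fails, some frame
solution has no classical extension past `T` (`TraceDensityCriterion.Negative.backwardBounded_of_hasSmoothExtensionPast`),
is NOT Type-I in time (`TerminalTrace.typeI_traceDensityCriterion`), and carries a vertex `x₀` at which the final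
value has vanishing scaled energy while `u` is not backward bounded. [folklore] -/
theorem TerminalTrace.not_traceDensityCriterion_normal_form_notTypeI (h : ¬ TraceDensityCriterion) :
    ∃ (ν T : ℝ) (u : ℝ → EuclideanSpace ℝ (Fin 3) → EuclideanSpace ℝ (Fin 3)) (p : ℝ → EuclideanSpace ℝ (Fin 3) → ℝ),
      0 < ν ∧ 0 < T ∧ IsClassicalNSSolutionOn (Ico 0 T) ν 0 u p ∧ IsLerayHopfOn T ν 0 (u 0) u ∧
      HasRapidSpatialDecay (u 0) ∧ ¬ HasSmoothExtensionPast ν 0 u T ∧ ¬ IsTypeIBlowup u T ∧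
      ∃ x₀ : EuclideanSpace ℝ (Fin 3),
        Tendsto (fun r : ℝ => r⁻¹ * ∫ x in ball x₀ r, ‖u T x‖ ^ 2) (𝓝[>] 0) (𝓝 0) ∧
        ¬ IsBackwardBoundedAt u T x₀ := by
  by_contra hall
  refine h fun ν T hν hT u p hcl hLH hdec x₀ hFE => ?_
  by_contra hnotbd
  have hext : ¬ HasSmoothExtensionPast ν 0 u T := fun hext =>
    hnotbd (TraceDensityCriterion.Negative.backwardBounded_of_hasSmoothExtensionPast hT hext x₀)
  have hTI : ¬ IsTypeIBlowup u T := fun hTI =>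
    hnotbd (TerminalTrace.typeI_traceDensityCriterion ν T hν hT u p hcl hLH hdec hTI x₀ hFE)
  exact hall ⟨ν, T, u, p, hν, hT, hcl, hLH, hdec, hext, hTI, x₀, hFE, hnotbd⟩

end Summit.NavierStokesRegularity.NavierStokesRegularity.Theorems

end
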